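import Summits.QuantumFields.YangMills.Theorems.AlphaInputsT3ACv3AdaptedClassR
import Summits.QuantumFields.YangMills.Theorems.AlphaInputsT3ACv3LocalSmallExact
import HarnessLib

/-!
# `AlphaInputsT3ACv3AdaptedClassX` — STRATEGY B for 2′: THE **SEAM-BLIND** ADAPTED CLASS `𝒞_X(k, h, W)` — g3's read-local class `𝒞_R` with the small-loop conjunct
# localised to the EXACT dependency of the (0.4) averaging: the loop conditions sit at the READ BONDS themselves (the read-bond family is closed under the
# exact dependency), never across `∂Ω_k(h)` ∕ `∂Λ_i(h)` — lane `pub-balaban3d`, seat alpha-2 (g4)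

WHY (this seat's STARTED line; HOME `D6L-STATUS-alpha2-g3.md` §7).  The v3 rows read a configuration only through bonds∕plaquettes INSIDE a read region
(`bondsIn k Ω_k(h)`, `plaqsIn s Λ_i(h)`, the boxes under the recorded plaquettes); the plaquettes straddling `∂Ω_k(h)` are read by no row — the FREE SEAM that a
charged datum with non-trivial holonomy around a hole of `Ω_k(h)` needs (for it no seam-regular exact lift exists: Stokes).  g3's class `𝒞_R` still reads the seam
through its small-loop conjunct `localSmallT3 = NestedSmallOn ℰp (δ/2) (hull readBondsT3) k`: the hull is built from the AXIOM-level relation `Feeds` (`b` issues from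
`B(c₋) ∪ B(c₊)`), which leaks one block outward per level, so loop conditions straddle the seam at scales `L, …, L^{k−1}`.  Over the EXACT relation `Feeds₂` (both
endpoints; `…v3LocalSmallExact`, this seat) the read-bond family is ALREADY dependency-closed (§2 `depClosed₂_readBondsT3`: the read regions are unions of blocks at every level they
are read), so the seam-blind small-loop class is simply `NestedSmallOn ℰp (δ/2) readBondsT3 k` (§3 `localSmallT3X ⊇ localSmallT3`), and the class
`𝒞_X := localSmallT3X ∩ reg68LocalSet ∩ large67Set ∩ [ChargedT3 → top42Set ∩ reg68LevelsSet] ⊇ 𝒞_R` (§3; so (D6R) ⇒ (D6X), nothing is lost).  §4: the W-independent core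
is closed and the averages of record are continuous on `localSmallT3X` at every read bond (`…v3LocalSmallExact` §2), which is all the selector needs (sibling `…AdaptedSelX`).  §0: the locality of
the concrete averages of record over `Feeds₂` (`loopHol_local₂`, `avgFun_local₂`, ★ `iter_blockAvg_local₂` = the glue lemma), read from `T4ReflectionConeSharp`.
HONEST FRAMING.  Kinematics∕topology; nothing of [B10]∕[7]∕[4]'s estimates asserted; the class is NOT claimed to contain print's (42)-minimiser and its non-emptiness is NOT
proved here; count-neutral helper toward R3 2′ (`stub_laneRecordsV3`, items 19935∕19936); nothing about d = 4, the continuum, or a mass gap.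

References: T. Bałaban, Commun. Math. Phys. 102 (1985) 255–275 [Balaban1985UV3] ((38)–(42) p.266, (67)–(68) p.273); CMP 98 (1985) 17–51 [Balaban1985Averaging] (p.24
locality); CMP 109 (1987) 249–301 [Balaban1987RG1] ((0.4) p.253).
-/

set_option autoImplicit false

noncomputable section

/-! ## §0 Locality of the concrete averages of record over the exact dependency relation -/

namespace Summit.QuantumFields.YangMills.Theorems.LocalSmallLoop

open Literature.MathematicalPhysics.QuantumFieldTheory.Balaban1983to89
open Literature.MathematicalPhysics.QuantumFieldTheory.Balaban1983to89.AveragingRT (axialAvg)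
open Literature.MathematicalPhysics.QuantumFieldTheory.Balaban1983to89.BlockAveraging (blockAvg blockAvg_avg avgFun loopHol)
open Literature.MathematicalPhysics.QuantumFieldTheory.Balaban1983to89.T4ReflectionConeSharp (loopHol_congr₂ axialAvg_congr₂ avgFun_congr₂)

variable {P : Params} {G : Type*} [GaugeGroup G] {j : ℕ}

/-- **SHARPER LOCALITY OF THE LOOP VARIABLES** (`T4ReflectionConeSharp.loopHol_congr₂` over `Feeds₂`): the (0.4) loop variables at `c` depend only on the bond variables of the bonds
with BOTH endpoints in `B(c₋) ∪ B(c₊)`. [cite: Balaban1985Averaging, (15) p.19] -/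
theorem loopHol_local₂ (hj : j + 1 ≤ P.m + P.K) (U U' : GaugeField P j G) (c : PBond P (j + 1))
    (hUU' : ∀ b : PBond P j, Feeds₂ b c → U b = U' b) : loopHol U c = loopHol U' c :=
  loopHol_congr₂ hj U U' c fun b h₁ h₂ => hUU' b ⟨h₁, h₂⟩

/-- **SHARPER LOCALITY OF THE STRAIGHT-LINE TRANSPORTER** (`T4ReflectionConeSharp.axialAvg_congr₂` over `Feeds₂`). [cite: Balaban1985Averaging, (15) p.19] -/
theorem axialAvg_local₂ (hj : j + 1 ≤ P.m + P.K) (U U' : GaugeField P j G) (c : PBond P (j + 1))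
    (hUU' : ∀ b : PBond P j, Feeds₂ b c → U b = U' b) : axialAvg U c = axialAvg U' c :=
  axialAvg_congr₂ hj U U' c fun b h₁ h₂ => hUU' b ⟨h₁, h₂⟩

/-- **SHARPER LOCALITY OF THE TOTAL BLOCK AVERAGING (0.4)** (`T4ReflectionConeSharp.avgFun_congr₂` over `Feeds₂`): `Ū(c)` depends only on the bond variables of the bonds with both
endpoints in `B(c₋) ∪ B(c₊)` (standing range). [cite: Balaban1985Averaging, p.24] -/
theorem avgFun_local₂ (ℰ : LoopAverage G) (hj : j + 1 ≤ P.m + P.K) (U U' : GaugeField P j G) (c : PBond P (j + 1))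
    (hUU' : ∀ b : PBond P j, Feeds₂ b c → U b = U' b) : avgFun ℰ U c = avgFun ℰ U' c :=
  avgFun_congr₂ ℰ hj U U' c fun b h₁ h₂ => hUU' b ⟨h₁, h₂⟩

/-- **★ LOCALITY OF THE AVERAGES OF RECORD ON AN EXACTLY DEPENDENCY-CLOSED FAMILY** (the glue lemma): two finest-lattice configurations that agree on the bonds of `E 0` have the same
`k`-fold average `(blockAvg ℰ)^k` at every bond of `E k` (`k` in the standing range). [cite: Balaban1985Averaging, p.24] -/
theorem iter_blockAvg_local₂ (ℰ : LoopAverage G) {E : (i : ℕ) → Set (PBond P i)} (hE : DepClosed₂ E) :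
    ∀ (k : ℕ), k ≤ P.m + P.K → ∀ (U U' : GaugeField P 0 G), (∀ b ∈ E 0, U b = U' b) →
      ∀ c ∈ E k, Averaging.iter (fun j => (blockAvg ℰ : Averaging P j G)) k U c = Averaging.iter (fun j => (blockAvg ℰ : Averaging P j G)) k U' c
  | 0, _, _, _, h, c, hc => h c hc
  | k + 1, hk, U, U', h, c, hc => by
    show (blockAvg ℰ).avg (Averaging.iter (fun j => (blockAvg ℰ : Averaging P j G)) k U) c =
      (blockAvg ℰ).avg (Averaging.iter (fun j => (blockAvg ℰ : Averaging P j G)) k U') c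
    rw [blockAvg_avg]
    exact avgFun_local₂ ℰ hk _ _ c fun b hb => iter_blockAvg_local₂ ℰ hE k (Nat.le_of_succ_le hk) U U' h b (hE k c hc b hb)

end Summit.QuantumFields.YangMills.Theorems.LocalSmallLoop

namespace Summit.QuantumFields.YangMills.Theorems

open MeasureTheory Set Topology TopologicalSpace
open scoped Matrix Matrix.Norms.L2Operator
open Literature.MathematicalPhysics.QuantumFieldTheory.Balaban1983to89
open Literature.MathematicalPhysics.QuantumFieldTheory.Balaban1983to89.T3ContinuumYM3Torus
open Literature.MathematicalPhysics.QuantumFieldTheory.Balaban1983to89.T3UnitLawDensityEML (ℰp)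
open Literature.MathematicalPhysics.QuantumFieldTheory.Balaban1983to89.B10Eq38TorusDomains (plaqsIn toFine toFine_succ)
open Literature.MathematicalPhysics.QuantumFieldTheory.Balaban1983to89.B10Eq42TorusConstraint (bondsIn lam42 lam42_self lam42_of_lt mem_bondsIn_of_mem_plaqsIn)
open Literature.MathematicalPhysics.QuantumFieldTheory.Balaban1985CMP102.Setting
open Summit.QuantumFields.Balaban3D.Carriers
open Summit.QuantumFields.Balaban3D.Proofs.Primitives (AlphaConsts)
open Summit.QuantumFields.BalabanUV.T4Continuum.SubstrateBlockAvgContinuity (smallContinuous_expMeanLogSU)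
open Summit.QuantumFields.YangMills.Theorems.BalabanUVNodesN08AlphaGroupTopology
open Summit.QuantumFields.YangMills.Theorems.LocalSmallLoop (hull subset_hull NestedSmallOn nestedSmallOn_antitone_family Feeds₂ DepClosed₂
  isClosed_nestedSmallOn₂ continuousOn_iter_eval₂ isClosed_nestedSmallOn_inter_plaqLe₂ iter_blockAvg_local₂)

/-! ## §1 Block saturation of the regions: membership in `Ω_j(h)`, `Λ_i(h)` depends only on the block at any level `≤` the region's -/

section Saturation

variable {P : Params}

/-- Coarsening factors through every intermediate level: equal `j′`-blocks give equal `j`-blocks for `j′ ≤ j`. [folklore] -/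
theorem coarsen_eq_of_coarsen_eq {j' : ℕ} {x y : Site P 0} (hxy : coarsen j' x = coarsen j' y) : ∀ {j : ℕ}, j' ≤ j → coarsen j x = coarsen j y
  | 0, hj => by
    have h0 : j' = 0 := Nat.le_zero.mp hj
    subst h0; exact hxy
  | j + 1, hj => by
    rcases Nat.lt_or_ge j' (j + 1) with hlt | hge
    · rw [coarsen_succ, coarsen_succ, coarsen_eq_of_coarsen_eq hxy (Nat.lt_succ_iff.mp hlt)]
    · have h1 : j' = j + 1 := le_antisymm hj hge
      subst h1; exact hxy

variable (M₁ : ℕ) (Rcol : ℕ → ℕ)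

/-- `Ω₀(h) = T_η` at every step (the general-`Params` form of NODE O's `Omega_level_zero`). [cite: Balaban1985UV3, (42) p.266] -/
theorem Omega_zero_eq_univ : ∀ (k : ℕ) (h : Hist P k), Omega M₁ Rcol k h 0 = Set.univ
  | 0, _ => rfl
  | k + 1, h => by rw [Omega_succ_of_le M₁ Rcol h (Nat.zero_le k)]; exact Omega_zero_eq_univ k h.proj

/-- **«Ω_j IS A UNION OF BLOCKS OF EVERY LEVEL `≤ j`»**: membership in `Ω_j(h)`, `j ≤ k`, depends only on the `j′`-block for any `j′ ≤ j` (`Ω₀ = T`; `Omega_bigBlock` for `j ≥ 1`).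
[cite: Balaban1985UV3, (39) p.266] -/
theorem mem_Omega_iff_of_coarsen_eq {k : ℕ} (h : Hist P k) {j j' : ℕ} (hj' : j' ≤ j) (hjk : j ≤ k) {x y : Site P 0} (hxy : coarsen j' x = coarsen j' y) :
    x ∈ Omega M₁ Rcol k h j ↔ y ∈ Omega M₁ Rcol k h j := by
  rcases Nat.eq_zero_or_pos j with rfl | hj
  · rw [Omega_zero_eq_univ M₁ Rcol k h]
    simp
  · refine Omega_bigBlock M₁ Rcol k h j hj hjk x y ?_
    funext μ
    show ((coarsen j x) μ).val / M₁ = ((coarsen j y) μ).val / M₁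
    rw [coarsen_eq_of_coarsen_eq hxy hj']

/-- **THE READ REGIONS `lam42 Ω(h) k i` ARE UNIONS OF BLOCKS OF EVERY LEVEL `≤ i`** (`i ≤ k`): membership depends only on the `j′`-block, `j′ ≤ i`.
[cite: Balaban1985UV3, (40)–(42) p.266] -/
theorem mem_lam42_iff_of_coarsen_eq {k : ℕ} (h : Hist P k) {i j' : ℕ} (hj' : j' ≤ i) (hik : i ≤ k) {x y : Site P 0} (hxy : coarsen j' x = coarsen j' y) :
    x ∈ lam42 (Omega M₁ Rcol k h) k i ↔ y ∈ lam42 (Omega M₁ Rcol k h) k i := by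
  rcases Nat.lt_or_ge i k with hlt | hge
  · rw [lam42_of_lt hlt, mem_sdiff, mem_sdiff, mem_Omega_iff_of_coarsen_eq M₁ Rcol h hj' hlt.le hxy,
      mem_Omega_iff_of_coarsen_eq M₁ Rcol h (Nat.le_succ_of_le hj') hlt hxy]
  · have hi : i = k := le_antisymm hik hge
    subst hi
    rw [lam42_self]
    exact mem_Omega_iff_of_coarsen_eq M₁ Rcol h hj' le_rfl hxy

end Saturation

/-! ## §2 The read-bond family is closed under the exact dependency -/

section T3

variable (F : T3Family) (𝔠 : AlphaConsts F.L (suGroupModel 2).N) (γ : ℝ) (hγ : 0 < γ) (hγ1 : γ ≤ (min 𝔠.gamma0 1) ^ 2) (K : ℕ)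

variable {F 𝔠 γ hγ hγ1 K} in
/-- **★ THE READ BONDS ARE CLOSED UNDER THE EXACT (0.4) DEPENDENCY** (`k ≤ K`): a level-`s` bond with both endpoints in the blocks of a read bond
`c ∈ bondsIn (s+1) (lam42 Ω(h) k i)`, `s + 1 ≤ i ≤ k`, has both fine representatives in `lam42 Ω(h) k i` (block saturation, §1) — it is itself a read bond.  So the exact
hull of the read bonds is the read-bond family and the seam-blind cone never leaves its read region. [cite: Balaban1985Averaging, p.24] -/
theorem AlphaInputsT3AC.depClosed₂_readBondsT3 {k : ℕ} (hk : k ≤ K) (h : Hist (F.P K) k) :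
    DepClosed₂ (AlphaInputsT3AC.readBondsT3 F 𝔠 γ hγ hγ1 K k h) := by
  intro s c hc b hb
  obtain ⟨i, hsi, hik, hc⟩ := hc
  have hs1 : s + 1 ≤ (F.P K).m + (F.P K).K := (hsi.trans hik).trans (AlphaInputsT3AC.le_standing_of_le hk)
  have hs0 : s ≤ (F.P K).m + (F.P K).K := (Nat.le_succ s).trans hs1
  -- both representatives of an endpoint of `b` share the `(s+1)`-block with the representative of an endpoint of `c`
  have key : ∀ (z : Site (F.P K) s) (y : Site (F.P K) (s + 1)), blockOf z = y →
      coarsen (s + 1) (toFine s z) = coarsen (s + 1) (toFine (s + 1) y) := by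
    intro z y hzy
    rw [coarsen_succ, coarsen_toFine s hs0, hzy, coarsen_toFine (s + 1) hs1]
  have hsrc : toFine (s + 1) c.src ∈ lam42 (Omega 𝔠.lane.carrier.M₁
      (rcolOf (T3Scales F γ hγ (hγ1.trans (sq_min_one_le _ 𝔠.gamma0_pos)) K) 𝔠.lane.carrier) k h) k i := hc.1
  have htgt : toFine (s + 1) c.tgt ∈ lam42 (Omega 𝔠.lane.carrier.M₁
      (rcolOf (T3Scales F γ hγ (hγ1.trans (sq_min_one_le _ 𝔠.gamma0_pos)) K) 𝔠.lane.carrier) k h) k i := hc.2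
  have mem_of : ∀ (z : Site (F.P K) s), (blockOf z = c.src ∨ blockOf z = c.tgt) →
      toFine s z ∈ lam42 (Omega 𝔠.lane.carrier.M₁ (rcolOf (T3Scales F γ hγ (hγ1.trans (sq_min_one_le _ 𝔠.gamma0_pos)) K) 𝔠.lane.carrier) k h) k i := by
    intro z hz
    rcases hz with hz | hz
    · exact (mem_lam42_iff_of_coarsen_eq _ _ h hsi hik (key z c.src hz)).mpr hsrc
    · exact (mem_lam42_iff_of_coarsen_eq _ _ h hsi hik (key z c.tgt hz)).mpr htgt
  exact ⟨i, (Nat.le_succ s).trans hsi, hik, mem_of b.src hb.1, mem_of b.tgt hb.2⟩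

/-! ## §3 The seam-blind small-loop class and the seam-blind adapted class -/

/-- **THE SEAM-BLIND SMALL-LOOP CLASS OF `(k, h)`**: the (0.4) loop variables of the averages of record of levels `< k` within `δ/2` AT THE READ BONDS (levels `1, …, k`) — the
localised class of `…v3LocalSmall` over the read-bond family itself, which is closed under the exact dependency (`depClosed₂_readBondsT3`).  Contains g2's `localSmallT3`
(`localSmallT3_subset_localSmallT3X`). [cite: Balaban1987RG1, (0.4) p.253] -/
def AlphaInputsT3AC.localSmallT3X (k : ℕ) (h : Hist (F.P K) k) : Set (GaugeField (F.P K) 0 (Matrix.specialUnitaryGroup (Fin 2) ℂ)) :=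
  NestedSmallOn ℰp (ℰp.δ / 2) (AlphaInputsT3AC.readBondsT3 F 𝔠 γ hγ hγ1 K k h) k

/-- **THE SEAM-BLIND ADAPTED CLASS `𝒞_X(k, h, W)`**: the seam-blind small-loop class, the read-local (68) set, (67)-largeness at the recorded plaquettes, and — for a CHARGED
datum — the top constraint (42) on `Ω_k(h)` with r3's multi-level regularity.  `𝒞_R ⊆ 𝒞_X` (`adaptedClassT3R_subset_adaptedClassT3X`).
[cite: Balaban1985UV3, (42) p.266 + (67)–(68) p.273] -/
def AlphaInputsT3AC.adaptedClassT3X (k : ℕ) (h : Hist (F.P K) k) (W : GaugeField (F.P K) k (Matrix.specialUnitaryGroup (Fin 2) ℂ)) :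
    Set (GaugeField (F.P K) 0 (Matrix.specialUnitaryGroup (Fin 2) ℂ)) :=
  {U | U ∈ AlphaInputsT3AC.localSmallT3X F 𝔠 γ hγ hγ1 K k h ∧
    U ∈ AlphaInputsT3AC.reg68LocalSet F 𝔠 γ hγ hγ1 K k h ∧
    U ∈ AlphaInputsT3AC.large67Set F 𝔠 γ hγ hγ1 K k h ∧
    (ChargedT3 F γ 𝔠.b₀ 𝔠.p₀ (avgWindowFactor F.L) K 𝔠.lane.carrier.M₁
        (rcolOf (T3Scales F γ hγ (hγ1.trans (sq_min_one_le _ 𝔠.gamma0_pos)) K) 𝔠.lane.carrier) k h W →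
      U ∈ AlphaInputsT3AC.top42Set F 𝔠 γ hγ hγ1 K k h W ∧ U ∈ AlphaInputsT3AC.reg68LevelsSet F 𝔠 γ hγ hγ1 K k h)}

variable {F 𝔠 γ hγ hγ1 K}

/-- Unfolding membership in the seam-blind small-loop class. [cite: Balaban1987RG1, (0.4) p.253] -/
theorem AlphaInputsT3AC.mem_localSmallT3X_iff {k : ℕ} {h : Hist (F.P K) k} {U : GaugeField (F.P K) 0 (Matrix.specialUnitaryGroup (Fin 2) ℂ)} :
    U ∈ AlphaInputsT3AC.localSmallT3X F 𝔠 γ hγ hγ1 K k h ↔ ∀ i, i < k → ∀ c ∈ AlphaInputsT3AC.readBondsT3 F 𝔠 γ hγ hγ1 K k h (i + 1), ∀ x : BlockAveraging.Idx (F.P K),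
      GaugeGroup.dist1 (BlockAveraging.loopHol (Averaging.iter (fun j => (BlockAveraging.blockAvg ℰp : Averaging (F.P K) j _)) i U) c x) ≤ ℰp.δ / 2 :=
  Iff.rfl

/-- Unfolding membership in the seam-blind adapted class. [folklore] -/
theorem AlphaInputsT3AC.mem_adaptedClassT3X_iff {k : ℕ} {h : Hist (F.P K) k} {W : GaugeField (F.P K) k (Matrix.specialUnitaryGroup (Fin 2) ℂ)}
    {U : GaugeField (F.P K) 0 (Matrix.specialUnitaryGroup (Fin 2) ℂ)} :
    U ∈ AlphaInputsT3AC.adaptedClassT3X F 𝔠 γ hγ hγ1 K k h W ↔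
      U ∈ AlphaInputsT3AC.localSmallT3X F 𝔠 γ hγ hγ1 K k h ∧
      U ∈ AlphaInputsT3AC.reg68LocalSet F 𝔠 γ hγ hγ1 K k h ∧
      U ∈ AlphaInputsT3AC.large67Set F 𝔠 γ hγ hγ1 K k h ∧
      (ChargedT3 F γ 𝔠.b₀ 𝔠.p₀ (avgWindowFactor F.L) K 𝔠.lane.carrier.M₁
          (rcolOf (T3Scales F γ hγ (hγ1.trans (sq_min_one_le _ 𝔠.gamma0_pos)) K) 𝔠.lane.carrier) k h W →
        U ∈ AlphaInputsT3AC.top42Set F 𝔠 γ hγ hγ1 K k h W ∧ U ∈ AlphaInputsT3AC.reg68LevelsSet F 𝔠 γ hγ hγ1 K k h) :=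
  Iff.rfl

/-- **`localSmallT3 ⊆ localSmallT3X`**: the g2 cone `hull readBondsT3` contains the read bonds, so its loop conditions imply the seam-blind ones. [cite: Balaban1987RG1, (0.4) p.253] -/
theorem AlphaInputsT3AC.localSmallT3_subset_localSmallT3X (k : ℕ) (h : Hist (F.P K) k) :
    AlphaInputsT3AC.localSmallT3 F 𝔠 γ hγ hγ1 K k h ⊆ AlphaInputsT3AC.localSmallT3X F 𝔠 γ hγ hγ1 K k h :=
  nestedSmallOn_antitone_family (subset_hull _) k

/-- **`𝒞_R ⊆ 𝒞_X`** — so (D6R) (hence (D6L), (D6)) implies the seam-blind non-emptiness row: the re-cut loses nothing. [cite: Balaban1985UV3, (42) p.266 + (67)–(68) p.273] -/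
theorem AlphaInputsT3AC.adaptedClassT3R_subset_adaptedClassT3X (k : ℕ) (h : Hist (F.P K) k) (W : GaugeField (F.P K) k (Matrix.specialUnitaryGroup (Fin 2) ℂ)) :
    AlphaInputsT3AC.adaptedClassT3R F 𝔠 γ hγ hγ1 K k h W ⊆ AlphaInputsT3AC.adaptedClassT3X F 𝔠 γ hγ hγ1 K k h W := by
  intro U hU
  obtain ⟨hN, hReg, hL, hrel⟩ := hU
  exact ⟨AlphaInputsT3AC.localSmallT3_subset_localSmallT3X k h hN, hReg, hL, hrel⟩

/-- **`𝒞_L ⊆ 𝒞_X` AT AN ADMISSIBLE HISTORY** (`k ≤ K`). [cite: Balaban1985UV3, (42) p.266 + (67)–(68) p.273] -/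
theorem AlphaInputsT3AC.adaptedClassT3L_subset_adaptedClassT3X {k : ℕ} (hk : k ≤ K) {h : Hist (F.P K) k}
    (hh : Hist.Admissible 𝔠.lane.carrier.M₁ (rcolOf (T3Scales F γ hγ (hγ1.trans (sq_min_one_le _ 𝔠.gamma0_pos)) K) 𝔠.lane.carrier) k h)
    (W : GaugeField (F.P K) k (Matrix.specialUnitaryGroup (Fin 2) ℂ)) :
    AlphaInputsT3AC.adaptedClassT3L F 𝔠 γ hγ hγ1 K k h W ⊆ AlphaInputsT3AC.adaptedClassT3X F 𝔠 γ hγ hγ1 K k h W :=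
  (AlphaInputsT3AC.adaptedClassT3L_subset_adaptedClassT3R hk hh W).trans (AlphaInputsT3AC.adaptedClassT3R_subset_adaptedClassT3X k h W)

/-- **★ THE GLUE LEMMA AT THE T³ OBJECTS**: two finest-lattice configurations that agree on every FINE read bond (`readBondsT3 k h 0` = the fine bonds with both endpoints in some
`Λ_i(h)`, `i ≤ k`, or in `Ω_k(h)`) have the same `s`-fold averages of record at every read bond of level `s ≤ k` (`k ≤ K`). [cite: Balaban1985Averaging, p.24] -/
theorem AlphaInputsT3AC.iter_eq_of_eqOn_readBonds {k : ℕ} (hk : k ≤ K) (h : Hist (F.P K) k)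
    {U U' : GaugeField (F.P K) 0 (Matrix.specialUnitaryGroup (Fin 2) ℂ)} (hUU' : ∀ b ∈ AlphaInputsT3AC.readBondsT3 F 𝔠 γ hγ hγ1 K k h 0, U b = U' b)
    {s : ℕ} (hs : s ≤ k) {c : PBond (F.P K) s} (hc : c ∈ AlphaInputsT3AC.readBondsT3 F 𝔠 γ hγ hγ1 K k h s) :
    Averaging.iter (fun j => (BlockAveraging.blockAvg ℰp : Averaging (F.P K) j _)) s U c =
      Averaging.iter (fun j => (BlockAveraging.blockAvg ℰp : Averaging (F.P K) j _)) s U' c :=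
  iter_blockAvg_local₂ ℰp (AlphaInputsT3AC.depClosed₂_readBondsT3 hk h) s (hs.trans (AlphaInputsT3AC.le_standing_of_le hk)) U U' hUU' c hc

/-! ## §4 Topology: the seam-blind small-loop class is closed and the averages of record are continuous on it at the read bonds -/

/-- **THE SEAM-BLIND SMALL-LOOP CLASS IS CLOSED** (`k ≤ K`; `LocalSmallLoop.isClosed_nestedSmallOn₂` at `ℰp`, margin `δ/2 < δ`, over the `DepClosed₂` read-bond family).
[cite: Balaban1987RG1, (0.4) p.253] -/
theorem AlphaInputsT3AC.isClosed_localSmallT3X {k : ℕ} (hk : k ≤ K) (h : Hist (F.P K) k) :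
    IsClosed (AlphaInputsT3AC.localSmallT3X F 𝔠 γ hγ hγ1 K k h) :=
  isClosed_nestedSmallOn₂ AlphaInputsT3AC.continuous_dist1_su2 smallContinuous_expMeanLogSU (by show ℰp.δ / 2 < ℰp.δ; linarith [ℰp.δ_pos])
    (AlphaInputsT3AC.depClosed₂_readBondsT3 hk h) (AlphaInputsT3AC.le_standing_of_le hk)

/-- On the seam-blind class the `s`-fold average of record is continuous at every read bond, `s ≤ k ≤ K`. [cite: Balaban1987RG1, (0.4) p.253] -/
theorem AlphaInputsT3AC.continuousOn_iter_readBondX {k : ℕ} (hk : k ≤ K) (h : Hist (F.P K) k) {s : ℕ} (hs : s ≤ k) {b : PBond (F.P K) s}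
    (hb : b ∈ AlphaInputsT3AC.readBondsT3 F 𝔠 γ hγ hγ1 K k h s) :
    ContinuousOn (fun U : GaugeField (F.P K) 0 (Matrix.specialUnitaryGroup (Fin 2) ℂ) =>
      Averaging.iter (fun l => BlockAveraging.blockAvg (P := F.P K) (j := l) ℰp) s U b) (AlphaInputsT3AC.localSmallT3X F 𝔠 γ hγ hγ1 K k h) :=
  continuousOn_iter_eval₂ AlphaInputsT3AC.continuous_dist1_su2 smallContinuous_expMeanLogSU (by show ℰp.δ / 2 < ℰp.δ; linarith [ℰp.δ_pos])
    (AlphaInputsT3AC.depClosed₂_readBondsT3 hk h) (AlphaInputsT3AC.le_standing_of_le hk) hs hb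

/-- **THE r3 SET IS CLOSED RELATIVE TO THE SEAM-BLIND CLASS** (every plaquette it reads has its four bonds among the read bonds). [cite: Balaban1985UV3, (68) p.273] -/
theorem AlphaInputsT3AC.isClosed_localSmallT3X_inter_reg68LevelsSet {k : ℕ} (hk : k ≤ K) (h : Hist (F.P K) k) :
    IsClosed (AlphaInputsT3AC.localSmallT3X F 𝔠 γ hγ hγ1 K k h ∩ AlphaInputsT3AC.reg68LevelsSet F 𝔠 γ hγ hγ1 K k h) := by
  refine AlphaInputsT3AC.isClosed_inter_setOf_forall_imp (AlphaInputsT3AC.isClosed_localSmallT3X hk h) fun i hi => ?_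
  refine AlphaInputsT3AC.isClosed_inter_setOf_forall_imp (AlphaInputsT3AC.isClosed_localSmallT3X hk h) fun s hs => ?_
  refine AlphaInputsT3AC.isClosed_inter_setOf_forall_imp (AlphaInputsT3AC.isClosed_localSmallT3X hk h) fun q hq => ?_
  obtain ⟨h₁, h₂, h₃, h₄⟩ := AlphaInputsT3AC.plaqBonds_mem_readBondsT3 (F := F) (𝔠 := 𝔠) (hγ1 := hγ1) hi hs hq
  exact isClosed_nestedSmallOn_inter_plaqLe₂ AlphaInputsT3AC.continuous_dist1_su2 smallContinuous_expMeanLogSU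
    (by show ℰp.δ / 2 < ℰp.δ; linarith [ℰp.δ_pos]) (AlphaInputsT3AC.depClosed₂_readBondsT3 hk h) (AlphaInputsT3AC.le_standing_of_le hk) (hs.trans hi) q
    h₁ h₂ h₃ h₄ _

/-- **THE W-INDEPENDENT CORE OF `𝒞_X` IS CLOSED** (`k ≤ K`): seam-blind small-loop class ∩ (read-local (68) set ∩ (67)-largeness).  (No admissibility needed.)
[cite: Balaban1985UV3, (67)–(68) p.273] -/
theorem AlphaInputsT3AC.isClosed_adaptedCoreX {k : ℕ} (hk : k ≤ K) {h : Hist (F.P K) k} :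
    IsClosed (AlphaInputsT3AC.localSmallT3X F 𝔠 γ hγ hγ1 K k h ∩
      (AlphaInputsT3AC.reg68LocalSet F 𝔠 γ hγ hγ1 K k h ∩ AlphaInputsT3AC.large67Set F 𝔠 γ hγ hγ1 K k h)) :=
  (AlphaInputsT3AC.isClosed_localSmallT3X hk h).inter (AlphaInputsT3AC.isClosed_reg68LocalSet_inter_large67Set (𝔠 := 𝔠) (hγ := hγ) (hγ1 := hγ1) hk)

end T3

end Summit.QuantumFields.YangMills.Theorems

end
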